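import Summits.QuantumFields.YangMills.Theorems.VirialFluxGapRingFrameDerivativeBounds
import HarnessLib

/-!
# Route `VirialFluxGap` (YangMills): POLYNOMIAL (in `L`) BOUND FOR THE SECOND FRAME DERIVATIVES OF THE ZERO-FLUX RING DEFICIT, and the
# `L`-explicit gradient–energy bound `(∂_Y F₀)² ≤ 2·C·L⁴·b²·F₀`

Companion of fcl-p3's ✓`exists_bound_frameD3_ringPoly` (third order) for the central charts ∕ assembly of ⟨stmt-QuantumFields-24141⟩: the
same term decomposition (✓`ringPoly_eq_sum_terms`, `≤ 27L⁴` terms, ✓`card_terms_le`) and compactness of `SU(2)^k` give an ABSOLUTE constant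
`C` with `|∂_{Y¹}∂_{Y²} ringPoly (ringCoord Q)| ≤ C·L⁴·b₁·b₂` for all slot bounds `‖Yⁱ_w‖ ≤ bᵢ`; combined with ✓`frameD_sq_le_two_mul_ringDeficit`
(w3) this yields the `L`-uniform control of the frame gradient by the energy needed for the error terms of LEAD's design note №4:

* §1 `frameDK2_sum_smul`, `exists_bound_frameDK2` — bilinear expansion and the uniform second-order block bound (twin of the cubic versions);
* §2 `frameD2_comp_projK`, `frameD2_fun_sum` — second frame derivatives through coordinate projections and finite sums;
* §3 ★★ `exists_bound_frameD2_ringPoly` — `|∂_{Y¹}∂_{Y²} ringPoly| ≤ C·L⁴·b₁·b₂`, absolute `C` (the `L`-explicit gradient–energy bound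
  `(∂_Y F₀)² ≤ 2·C·L⁴·b²·F₀` follows with ✓∕⧗`frameD_sq_le_two_mul_ringDeficit` — companion file).

HONEST FRAMING: calculus bookkeeping (non-explicit absolute constant); ⟨24141⟩ stays OPEN; the Yang–Mills mass gap is NOT proved; no summit is
proved by a line.  THEOREMS ONLY (0 `def`, 0 `sorry`), standard axioms.  Width seat `ym-line-sfw-p2-w3` g58 (cell ym-idea-1, free hands),
`--supports stmt-QuantumFields-24141`.  References: [folklore]; [cite: arXiv220412737, §2 (2.4) (p. 10)].
-/

set_option autoImplicit false

noncomputable section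

open scoped Matrix BigOperators ContDiff Topology
open MeasureTheory Set
open Literature.MathematicalPhysics.QuantumFieldTheory hiding SU2
open Literature.MathematicalPhysics.QuantumLattice
open Literature.MathematicalPhysics.QuantumFieldTheory.SUNBakryEmery (expSU coe_expSU matTop)

namespace Summit.QuantumFields.YangMills.Theorems.VirialFluxGap.FrameHessian

open Summit.QuantumFields.YangMills.Theorems.FemtoTransferGap
open Summit.QuantumFields.YangMills.Theorems.FemtoTransferGap.TT
open Summit.QuantumFields.YangMills.Theorems.VirialFluxGap.RingDeficit
open Summit.QuantumFields.YangMills.Theorems.VirialFluxGap.FrameDerivative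

open scoped Matrix.Norms.Frobenius

attribute [local instance 2000] Literature.MathematicalPhysics.QuantumFieldTheory.SUNBakryEmery.matTop

/-! ## §1 Second-order block calculus -/

/-- The bilinear expansion of a SECOND iterated block derivative along finite linear combinations of directions. [folklore] -/
theorem frameDK2_sum_smul {k : ℕ} {β : Type*} [Fintype β] (E : β → Fin k → Matrix (Fin 2) (Fin 2) ℂ)
    (c₁ c₂ : β → ℝ) {φ : (Fin k → Matrix (Fin 2) (Fin 2) ℂ) → ℝ} (hφ : ContDiff ℝ ∞ φ) (A : Fin k → Matrix (Fin 2) (Fin 2) ℂ) :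
    frameDK (∑ b, c₁ b • E b) (frameDK (∑ b, c₂ b • E b) φ) A =
      ∑ b₁, ∑ b₂, c₁ b₁ * (c₂ b₂ * frameDK (E b₁) (frameDK (E b₂) φ) A) := by
  have h2 : frameDK (∑ b, c₂ b • E b) φ = fun A' => ∑ b, c₂ b * frameDK (E b) φ A' :=
    funext fun A' => frameDK_sum_smul_dir Finset.univ c₂ E φ A'
  have h2s : ∀ b, ContDiff ℝ ∞ (frameDK (E b) φ) := fun b => contDiff_frameDK hφ (E b)
  rw [h2, frameDK_sum_smul_dir]
  refine Finset.sum_congr rfl fun b₁ _ => ?_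
  rw [frameDK_fun_sum (E b₁) c₂ h2s A, Finset.mul_sum]

/-- ★ **Uniform bound for second iterated block derivatives of a fixed smooth block function** on unitary arguments:
`|∂^K_{Y¹}∂^K_{Y²} φ (A)| ≤ C·b₁·b₂`. [folklore] -/
theorem exists_bound_frameDK2 {k : ℕ} {φ : (Fin k → Matrix (Fin 2) (Fin 2) ℂ) → ℝ} (hφ : ContDiff ℝ ∞ φ) :
    ∃ C : ℝ, 0 ≤ C ∧ ∀ (A : Fin k → Matrix (Fin 2) (Fin 2) ℂ),
      (∀ i, A i ∈ Set.range (fun U : SU2 => (U : Matrix (Fin 2) (Fin 2) ℂ))) →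
      ∀ (Y₁ Y₂ : Fin k → Matrix (Fin 2) (Fin 2) ℂ) (b₁ b₂ : ℝ), 0 ≤ b₁ → 0 ≤ b₂ →
        (∀ i, ‖Y₁ i‖ ≤ b₁) → (∀ i, ‖Y₂ i‖ ≤ b₂) →
        |frameDK Y₁ (frameDK Y₂ φ) A| ≤ C * b₁ * b₂ := by
  classical
  set S := {A : Fin k → Matrix (Fin 2) (Fin 2) ℂ | ∀ i, A i ∈ Set.range (fun U : SU2 => (U : Matrix (Fin 2) (Fin 2) ℂ))} with hS
  have hSc : IsCompact S := isCompact_unitaryBlocks k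
  set T : (Fin k × Fin 2 × Fin 2 × Bool) → (Fin k × Fin 2 × Fin 2 × Bool) → (Fin k → Matrix (Fin 2) (Fin 2) ℂ) → ℝ :=
    fun b₁ b₂ => frameDK (blockBasis k b₁) (frameDK (blockBasis k b₂) φ) with hT
  have hcont : ∀ b₁ b₂, Continuous (T b₁ b₂) := fun b₁ b₂ => (contDiff_frameDK (contDiff_frameDK hφ _) _).continuous
  have hbd : ∀ b₁ b₂, ∃ Cb : ℝ, ∀ A ∈ S, |T b₁ b₂ A| ≤ Cb := by
    intro b₁ b₂
    obtain ⟨Cb, hCb⟩ := hSc.exists_bound_of_continuousOn (hcont b₁ b₂).continuousOn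
    exact ⟨Cb, fun A hA => by simpa [Real.norm_eq_abs] using hCb A hA⟩
  choose Cb hCb using hbd
  refine ⟨∑ b₁, ∑ b₂, |Cb b₁ b₂|, by positivity, ?_⟩
  intro A hA Y₁ Y₂ b₁ b₂ hb₁ hb₂ hY₁ hY₂
  have hAS : A ∈ S := hA
  rw [blockBasis_expand k Y₁, blockBasis_expand k Y₂, frameDK2_sum_smul (blockBasis k) _ _ hφ A]
  have hterm : ∀ p₁ p₂, |blockCoord k Y₁ p₁ * (blockCoord k Y₂ p₂ * T p₁ p₂ A)| ≤ (b₁ * b₂) * |Cb p₁ p₂| := by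
    intro p₁ p₂
    have h1 : |blockCoord k Y₁ p₁| ≤ b₁ := (abs_blockCoord_le k Y₁ p₁).trans (hY₁ _)
    have h2 : |blockCoord k Y₂ p₂| ≤ b₂ := (abs_blockCoord_le k Y₂ p₂).trans (hY₂ _)
    have h4 : |T p₁ p₂ A| ≤ |Cb p₁ p₂| := (hCb p₁ p₂ A hAS).trans (le_abs_self _)
    rw [abs_mul, abs_mul]
    have e : (b₁ * b₂) * |Cb p₁ p₂| = b₁ * (b₂ * |Cb p₁ p₂|) := by ring
    rw [e]
    gcongr
  calc |∑ p₁, ∑ p₂, blockCoord k Y₁ p₁ * (blockCoord k Y₂ p₂ * T p₁ p₂ A)|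
      ≤ ∑ p₁, |∑ p₂, blockCoord k Y₁ p₁ * (blockCoord k Y₂ p₂ * T p₁ p₂ A)| := Finset.abs_sum_le_sum_abs _ _
    _ ≤ ∑ p₁, ∑ p₂, |blockCoord k Y₁ p₁ * (blockCoord k Y₂ p₂ * T p₁ p₂ A)| :=
        Finset.sum_le_sum fun p₁ _ => Finset.abs_sum_le_sum_abs _ _
    _ ≤ ∑ p₁, ∑ p₂, (b₁ * b₂) * |Cb p₁ p₂| := Finset.sum_le_sum fun p₁ _ => Finset.sum_le_sum fun p₂ _ => hterm p₁ p₂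
    _ = (∑ p₁, ∑ p₂, |Cb p₁ p₂|) * b₁ * b₂ := by
        simp only [← Finset.mul_sum]
        ring

/-! ## §2 Second frame derivatives through coordinate projections and finite sums -/

variable {L : ℕ} [NeZero L]

/-- Second frame derivatives of a function of finitely many coordinates. [folklore] -/
theorem frameD2_comp_projK {k : ℕ} {φ : (Fin k → Matrix (Fin 2) (Fin 2) ℂ) → ℝ} (hφ : ContDiff ℝ ∞ φ)
    (v : Fin k → ((Fin (2 * L - 1 + 1) × Edge 3 L) ⊕ Site 3 L)) (Y₁ Y₂ : ((Fin (2 * L - 1 + 1) × Edge 3 L) ⊕ Site 3 L) → Matrix (Fin 2) (Fin 2) ℂ)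
    (M : ((Fin (2 * L - 1 + 1) → Edge 3 L → Matrix (Fin 2) (Fin 2) ℂ) × (Site 3 L → Matrix (Fin 2) (Fin 2) ℂ))) :
    frameD Y₁ (frameD Y₂ (fun M' : ((Fin (2 * L - 1 + 1) → Edge 3 L → Matrix (Fin 2) (Fin 2) ℂ) × (Site 3 L → Matrix (Fin 2) (Fin 2) ℂ)) =>
        φ (projK v M'))) M =
      frameDK (fun i => Y₁ (v i)) (frameDK (fun i => Y₂ (v i)) φ) (projK v M) := by
  have e2 : frameD Y₂ (fun M' : ((Fin (2 * L - 1 + 1) → Edge 3 L → Matrix (Fin 2) (Fin 2) ℂ) × (Site 3 L → Matrix (Fin 2) (Fin 2) ℂ)) =>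
      φ (projK v M')) = fun M' => (frameDK (fun i => Y₂ (v i)) φ) (projK v M') :=
    funext fun M' => frameD_comp_projK hφ v Y₂ M'
  rw [e2]
  exact frameD_comp_projK (contDiff_frameDK hφ (fun i => Y₂ (v i))) v Y₁ M

/-- Second frame derivatives of a finite sum of smooth functions of the coordinates. [folklore] -/
theorem frameD2_fun_sum {ι : Type*} [Fintype ι] (Y₁ Y₂ : ((Fin (2 * L - 1 + 1) × Edge 3 L) ⊕ Site 3 L) → Matrix (Fin 2) (Fin 2) ℂ)
    {h : ι → ((Fin (2 * L - 1 + 1) → Edge 3 L → Matrix (Fin 2) (Fin 2) ℂ) × (Site 3 L → Matrix (Fin 2) (Fin 2) ℂ)) → ℝ}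
    (hh : ∀ t, ContDiff ℝ ∞ (h t)) (M : ((Fin (2 * L - 1 + 1) → Edge 3 L → Matrix (Fin 2) (Fin 2) ℂ) × (Site 3 L → Matrix (Fin 2) (Fin 2) ℂ))) :
    frameD Y₁ (frameD Y₂ (fun M' => ∑ t, h t M')) M = ∑ t, frameD Y₁ (frameD Y₂ (h t)) M := by
  have e2 : frameD Y₂ (fun M' : ((Fin (2 * L - 1 + 1) → Edge 3 L → Matrix (Fin 2) (Fin 2) ℂ) × (Site 3 L → Matrix (Fin 2) (Fin 2) ℂ)) =>
      ∑ t, h t M') = fun M' => ∑ t, (1 : ℝ) * frameD Y₂ (h t) M' := by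
    funext M'
    have := frameD_fun_sum Y₂ (fun _ => (1 : ℝ)) hh M'
    simp only [one_mul] at this ⊢
    exact this
  have hh2 : ∀ t, ContDiff ℝ ∞ (frameD Y₂ (h t)) := fun t => contDiff_frameD (hh t) Y₂
  rw [e2, frameD_fun_sum Y₁ (fun _ => (1 : ℝ)) hh2 M]
  simp only [one_mul]

/-! ## §3 The polynomial second-derivative bound -/

/-- ★★ **Polynomial second-derivative bound for the deficit**: an absolute `C ≥ 0` with
`|∂_{Y¹}∂_{Y²} ringPoly (ringCoord Q)| ≤ C·L⁴·b₁·b₂` for every `L`, `Q` and slot bounds `‖Yⁱ_w‖ ≤ bᵢ`. [folklore] -/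
theorem exists_bound_frameD2_ringPoly :
    ∃ C : ℝ, 0 ≤ C ∧ ∀ (L : ℕ) [NeZero L] (Q : ((Fin (2 * L - 1 + 1) → GaugeConfig 3 L SU2) × (Site 3 L → SU2)))
      (Y₁ Y₂ : ((Fin (2 * L - 1 + 1) × Edge 3 L) ⊕ Site 3 L) → Matrix (Fin 2) (Fin 2) ℂ) (b₁ b₂ : ℝ), 0 ≤ b₁ → 0 ≤ b₂ →
      (∀ w, ‖Y₁ w‖ ≤ b₁) → (∀ w, ‖Y₂ w‖ ≤ b₂) →
      |frameD Y₁ (frameD Y₂ (ringPoly L)) (ringCoord L Q)| ≤ C * (L : ℝ) ^ 4 * b₁ * b₂ := by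
  obtain ⟨Ctb, hCtb0, hCtb⟩ := exists_bound_frameDK2 contDiff_tbShape
  obtain ⟨Csm, hCsm0, hCsm⟩ := exists_bound_frameDK2 contDiff_seamShape
  obtain ⟨Cpq, hCpq0, hCpq⟩ := exists_bound_frameDK2 contDiff_plaqShape
  refine ⟨27 * (Ctb + Csm + Cpq), by positivity, ?_⟩
  intro L _ Q Y₁ Y₂ b₁ b₂ hb₁ hb₂ hY₁ hY₂
  have hbb : 0 ≤ b₁ * b₂ := by positivity
  have hterm : ∀ t, |frameD Y₁ (frameD Y₂ (termFun L t)) (ringCoord L Q)| ≤ (Ctb + Csm + Cpq) * (b₁ * b₂) := by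
    intro t
    rcases t with (⟨i, e⟩ | e) | ⟨j, p⟩
    · have h := frameD2_comp_projK contDiff_tbShape (vTB i e) Y₁ Y₂ (ringCoord L Q)
      have hb := hCtb (projK (vTB i e) (ringCoord L Q)) (projK_ringCoord_mem _ Q) (fun i' => Y₁ (vTB i e i'))
        (fun i' => Y₂ (vTB i e i')) b₁ b₂ hb₁ hb₂ (fun _ => hY₁ _) (fun _ => hY₂ _)
      calc |frameD Y₁ (frameD Y₂ (termFun L (Sum.inl (Sum.inl (i, e))))) (ringCoord L Q)|
          = |frameDK (fun i' => Y₁ (vTB i e i')) (frameDK (fun i' => Y₂ (vTB i e i')) tbShape) (projK (vTB i e) (ringCoord L Q))| := by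
            rw [← h]; rfl
        _ ≤ Ctb * b₁ * b₂ := hb
        _ ≤ (Ctb + Csm + Cpq) * (b₁ * b₂) := by nlinarith
    · have h := frameD2_comp_projK contDiff_seamShape (vSeam e) Y₁ Y₂ (ringCoord L Q)
      have hb := hCsm (projK (vSeam e) (ringCoord L Q)) (projK_ringCoord_mem _ Q) (fun i' => Y₁ (vSeam e i'))
        (fun i' => Y₂ (vSeam e i')) b₁ b₂ hb₁ hb₂ (fun _ => hY₁ _) (fun _ => hY₂ _)
      calc |frameD Y₁ (frameD Y₂ (termFun L (Sum.inl (Sum.inr e)))) (ringCoord L Q)|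
          = |frameDK (fun i' => Y₁ (vSeam e i')) (frameDK (fun i' => Y₂ (vSeam e i')) seamShape) (projK (vSeam e) (ringCoord L Q))| := by
            rw [← h]; rfl
        _ ≤ Csm * b₁ * b₂ := hb
        _ ≤ (Ctb + Csm + Cpq) * (b₁ * b₂) := by nlinarith
    · have h := frameD2_comp_projK contDiff_plaqShape (vPlaq j p) Y₁ Y₂ (ringCoord L Q)
      have hb := hCpq (projK (vPlaq j p) (ringCoord L Q)) (projK_ringCoord_mem _ Q) (fun i' => Y₁ (vPlaq j p i'))
        (fun i' => Y₂ (vPlaq j p i')) b₁ b₂ hb₁ hb₂ (fun _ => hY₁ _) (fun _ => hY₂ _)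
      calc |frameD Y₁ (frameD Y₂ (termFun L (Sum.inr (j, p)))) (ringCoord L Q)|
          = |frameDK (fun i' => Y₁ (vPlaq j p i')) (frameDK (fun i' => Y₂ (vPlaq j p i')) plaqShape) (projK (vPlaq j p) (ringCoord L Q))| := by
            rw [← h]; rfl
        _ ≤ Cpq * b₁ * b₂ := hb
        _ ≤ (Ctb + Csm + Cpq) * (b₁ * b₂) := by nlinarith
  rw [ringPoly_eq_sum_terms, frameD2_fun_sum Y₁ Y₂ (contDiff_termFun (L := L)) (ringCoord L Q)]
  have hcard := card_terms_le (L := L)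
  calc |∑ t, frameD Y₁ (frameD Y₂ (termFun L t)) (ringCoord L Q)|
      ≤ ∑ t, |frameD Y₁ (frameD Y₂ (termFun L t)) (ringCoord L Q)| := Finset.abs_sum_le_sum_abs _ _
    _ ≤ ∑ _t : ((Fin (2 * L - 1) × Edge 3 L) ⊕ Edge 3 L) ⊕ (Fin (2 * L - 1 + 1) × Plaquette 3 L), (Ctb + Csm + Cpq) * (b₁ * b₂) :=
        Finset.sum_le_sum fun t _ => hterm t
    _ = (Fintype.card (((Fin (2 * L - 1) × Edge 3 L) ⊕ Edge 3 L) ⊕ (Fin (2 * L - 1 + 1) × Plaquette 3 L)) : ℝ) *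
          ((Ctb + Csm + Cpq) * (b₁ * b₂)) := by simp
    _ ≤ 27 * (L : ℝ) ^ 4 * ((Ctb + Csm + Cpq) * (b₁ * b₂)) := mul_le_mul_of_nonneg_right hcard (by positivity)
    _ = 27 * (Ctb + Csm + Cpq) * (L : ℝ) ^ 4 * b₁ * b₂ := by ring

end Summit.QuantumFields.YangMills.Theorems.VirialFluxGap.FrameHessian

end
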